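import Mathlib.RingTheory.MvPowerSeries.Order
import Mathlib.RingTheory.MvPowerSeries.Inverse
import Literature.RingTheory.MvPowerSeries.AdicTaylor
import Literature.RingTheory.MvPowerSeries.MaximalIdealPow
import Literature.AlgebraicGeometry.Resolution.RegularLocalOrderValuation
import HarnessLib

/-!
# Divided (Hasse) derivatives detect the order of a power series EXACTLY (a derivative of order `ord f` gives a unit)

Topic `Literature/RingTheory/MvPowerSeries`, companion of `AdicTaylor.lean` (`hasseDeriv α`, the divided partial
derivative `Δ_α` of `A⟦X_τ⟧`, `coeff β (Δ_α f) = C(α+β, α) · coeff (α+β) f`) and of `HasseDerivOrder.lean` (the LOWER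
bound `ord f ≤ ord (Δ_α f) + |α|` and Lucas selection); this file adds the complementary ATTAINMENT statement. Everything here is PROVED. Source
read on the page (held text `paper:arxiv-math_0606795`, chunk p0009 L1–L24): O. Villamayor U., *Rees algebras on smooth
schemes: integral closure and higher differential operators*, Rev. Mat. Iberoam. 24 (2008) [VillamayorU2008ReesDiff],
§4.1: «Recall that the order of a non-zero ideal `I` at a local regular ring `(R,M)` is the biggest integer `b` such that
`I ⊂ M^b`. … `(Diff^{b−1}_k(I))_x = ⟨Δ^α(f) / f ∈ I, 0 ≤ |α| ≤ b−1⟩`. One can now check at `O_{Z,x}`, or at the ring of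
formal power series `Ô_{Z,x}`, that `Diff^{b−1}_k(I)` is a proper ideal if and only if `I` has order at least `b` at the
local ring.» The polynomial-ring (origin) form is the tree's `Resolution.diffIdeal_le_idealOfVars_iff` /
`diffIdeal_not_le_idealOfVars_of_not_le_pow_succ` (`HasseSchmidtDerivatives.lean`); this file is the FORMAL POWER
SERIES form, element by element (the complete-local-ring model `κ⟦x₁,…,xₙ⟧` of a regular local ring with coefficient
field), for the tree's power-series divided derivatives `hasseDeriv` (Bourbaki, *Commutative Algebra* Ch. III §4
no. 5 (21) [Bourbaki1989CommAlg]):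

* `coeff_zero_hasseDeriv`, `constantCoeff_hasseDeriv` — `(Δ_α f)(0) = coeff_α f` (any commutative ring `A`);
* `exists_hasseDeriv_constantCoeff_ne_zero_of_order_eq` — if `f.order = δ` (`MvPowerSeries.order`, least total degree
  of a nonzero coefficient) then some `Δ_α` with `|α| = δ` has `(Δ_α f)(0) ≠ 0` (any commutative ring);
* over a FIELD `K`: `exists_hasseDeriv_isUnit_of_order_eq` (that `Δ_α f` is a unit of `K⟦x⟧`) and
  `exists_hasseDeriv_order_eq_zero_of_order_eq` (`(Δ_α f).order = 0`);
* `adicOrder_eq_order` — on `K⟦x_σ⟧`, `σ` finite, the `𝔪`-adic order of the tree (`Resolution.adicOrder`,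
  «`n ≤ ord f ⟺ f ∈ 𝔪ⁿ`») is `MvPowerSeries.order` (via `Jets.le_order_iff_mem_maximalIdeal_pow`; universe-polymorphic
  form of the bridge proved for `K σ : Type` in `Summit.….Theorems.CampaignW21` / `MarkedTransferCampaignW21MinDegreeTop`);
* `exists_hasseDeriv_adicOrder_eq_zero_of_adicOrder_eq` — `ord f = δ ⟹ ∃ α, |α| = δ ∧ ord (Δ_α f) = 0`: an element of
  order exactly `δ` is taken to a UNIT by a divided derivative of order exactly `δ` (and by none of order `< δ`:
  `one_le_adicOrder_hasseDeriv_of_degree_lt`).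

Bearing (index only; nothing from it is used or asserted): H. Hironaka, *Resolution of singularities in positive
characteristics* (ms. 2017) p.60 l.33–36 «ord_ζ(g_i) = δ … We then pick a differential operator ∂ ∈ Diff^{(δ)}_{Z,ξ}
such that ord_ζ(∂(g(i))) = 1» (unrefereed manuscript under adjudication, campaign res-hironaka; GAP row R07 key
p61:Th10.5: the typed sibling `Hironaka2017.S10LLChainMod.U60_2_partial_ours` reads «= 0»; this file is the
complete-model statement that order `0` IS attained by some `Δ_α`, `|α| = δ`. Deliberately NOT here: the Cohen
isomorphism `Ô_{Z,ζ} ≅ κ(ζ)⟦x⟧` at a closed point of a smooth scheme over a perfect field, and the action of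
`Diff_{Z}` on the completion.
-/

noncomputable section

open _root_.MvPowerSeries Finsupp IsLocalRing

namespace Literature.RingTheory.MvPowerSeries

universe u v

/-! ## The constant term of a divided derivative (any commutative ring) -/

section AnyRing

variable {A : Type u} [CommRing A] {τ : Type v}

/-- **`coeff_0 (Δ_α f) = coeff_α f`**: the multi-index binomial `C(α, α) = 1` — the constant term of the coefficient
`Δ_α f` of `Y^α` in `f(X + Y)` (Bourbaki's (21)) is the coefficient of `X^α` in `f`.
[cite: Bourbaki1989CommAlg, Ch. III §4 no. 5 (21)] -/
theorem coeff_zero_hasseDeriv (α : τ →₀ ℕ) (f : MvPowerSeries τ A) :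
    coeff (0 : τ →₀ ℕ) (hasseDeriv α f) = coeff α f := by
  rw [coeff_hasseDeriv, add_zero]
  have h1 : (α.prod fun s n => n.choose (α s)) = 1 :=
    Finset.prod_eq_one fun s _ => Nat.choose_self (α s)
  rw [h1, Nat.cast_one, one_mul]

/-- **`(Δ_α f)(0) = coeff_α f`** (constant coefficient). [cite: Bourbaki1989CommAlg, Ch. III §4 no. 5 (21)] -/
theorem constantCoeff_hasseDeriv (α : τ →₀ ℕ) (f : MvPowerSeries τ A) :
    constantCoeff (hasseDeriv α f) = coeff α f := by
  rw [← coeff_zero_eq_constantCoeff_apply, coeff_zero_hasseDeriv]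

/-- If `f.order = δ` then some divided derivative of order exactly `δ` has nonzero constant term: take `α` with
`|α| = δ` and `coeff_α f ≠ 0` (`MvPowerSeries.order_eq_nat`) — the element form, «at the ring of formal power series»,
of Villamayor's «`Diff^{b−1}_k(I)` is a proper ideal if and only if `I` has order at least `b`» (with `b = δ + 1`,
`I = (f)`: `Diff^{δ}((f))` is NOT proper). [cite: VillamayorU2008ReesDiff, §4.1] -/
theorem exists_hasseDeriv_constantCoeff_ne_zero_of_order_eq {f : MvPowerSeries τ A} {δ : ℕ}
    (h : f.order = δ) : ∃ α : τ →₀ ℕ, α.degree = δ ∧ constantCoeff (hasseDeriv α f) ≠ 0 := by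
  obtain ⟨⟨α, hα, hdeg⟩, -⟩ := MvPowerSeries.order_eq_nat.mp h
  exact ⟨α, hdeg, by rwa [constantCoeff_hasseDeriv]⟩

/-- Conversely, divided derivatives of order `< ord f` have vanishing constant term (the direction «`I` of order `≥ b` ⟹
`Diff^{b−1}(I)` proper»). [cite: VillamayorU2008ReesDiff, §4.1] -/
theorem constantCoeff_hasseDeriv_eq_zero_of_degree_lt {f : MvPowerSeries τ A} {α : τ →₀ ℕ}
    (h : (α.degree : ℕ∞) < f.order) : constantCoeff (hasseDeriv α f) = 0 := by
  rw [constantCoeff_hasseDeriv]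
  exact MvPowerSeries.coeff_of_lt_order h

end AnyRing

/-! ## Over a field: a divided derivative of order `ord f` is a unit -/

section Field

variable {K : Type u} [Field K] {σ : Type v}

/-- **`f.order = δ ⟹ ∃ α, |α| = δ ∧ Δ_α f ∈ K⟦x⟧ˣ`** (over a field a series with nonzero constant term is a unit).
[cite: VillamayorU2008ReesDiff, §4.1] -/
theorem exists_hasseDeriv_isUnit_of_order_eq {f : MvPowerSeries σ K} {δ : ℕ} (h : f.order = δ) :
    ∃ α : σ →₀ ℕ, α.degree = δ ∧ IsUnit (hasseDeriv α f) := by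
  obtain ⟨α, hdeg, hc⟩ := exists_hasseDeriv_constantCoeff_ne_zero_of_order_eq h
  exact ⟨α, hdeg, MvPowerSeries.isUnit_iff_constantCoeff.mpr (isUnit_iff_ne_zero.mpr hc)⟩

/-- **`f.order = δ ⟹ ∃ α, |α| = δ ∧ (Δ_α f).order = 0`.** [cite: VillamayorU2008ReesDiff, §4.1] -/
theorem exists_hasseDeriv_order_eq_zero_of_order_eq {f : MvPowerSeries σ K} {δ : ℕ} (h : f.order = δ) :
    ∃ α : σ →₀ ℕ, α.degree = δ ∧ (hasseDeriv α f).order = 0 := by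
  obtain ⟨α, hdeg, hc⟩ := exists_hasseDeriv_constantCoeff_ne_zero_of_order_eq h
  refine ⟨α, hdeg, ?_⟩
  by_contra hne
  exact hc (MvPowerSeries.order_ne_zero_iff_constCoeff_eq_zero.mp hne)

variable [Finite σ]

/-- **Bridge** (universe-polymorphic): on `K⟦x_σ⟧`, `σ` finite, the `𝔪`-adic order `Resolution.adicOrder`
(«the order of a non-zero ideal `I` at a local regular ring `(R, M)` is the biggest integer `b` such that `I ⊂ M^b`»,
here for a principal ideal; «`n ≤ ord f ⟺ f ∈ 𝔪ⁿ`») equals `MvPowerSeries.order` (least total degree of a nonzero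
coefficient), by `Jets.le_order_iff_mem_maximalIdeal_pow`. [cite: VillamayorU2008ReesDiff, §4.1] -/
theorem adicOrder_eq_order (f : MvPowerSeries σ K) :
    Literature.AlgebraicGeometry.Resolution.adicOrder f = f.order := by
  apply le_antisymm
  · refine ENat.forall_natCast_le_iff_le.mp fun k hk => ?_
    exact Jets.le_order_iff_mem_maximalIdeal_pow.mpr
      ((Literature.AlgebraicGeometry.Resolution.le_adicOrder_iff f k).mp hk)
  · refine ENat.forall_natCast_le_iff_le.mp fun k hk => ?_
    exact (Literature.AlgebraicGeometry.Resolution.le_adicOrder_iff f k).mpr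
      (Jets.le_order_iff_mem_maximalIdeal_pow.mp hk)

/-- **An element of `𝔪`-adic order exactly `δ` is taken to a unit (order `0`) by some divided derivative of order
exactly `δ`** («one can now check … at the ring of formal power series … that `Diff^{b−1}_k(I)` is a proper ideal if and
only if `I` has order at least `b`», element form with `b = δ + 1`). [cite: VillamayorU2008ReesDiff, §4.1] -/
theorem exists_hasseDeriv_adicOrder_eq_zero_of_adicOrder_eq {f : MvPowerSeries σ K} {δ : ℕ}
    (h : Literature.AlgebraicGeometry.Resolution.adicOrder f = δ) :
    ∃ α : σ →₀ ℕ, α.degree = δ ∧ Literature.AlgebraicGeometry.Resolution.adicOrder (hasseDeriv α f) = 0 := by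
  rw [adicOrder_eq_order] at h
  obtain ⟨α, hdeg, h0⟩ := exists_hasseDeriv_order_eq_zero_of_order_eq h
  exact ⟨α, hdeg, by rw [adicOrder_eq_order, h0]⟩

/-- The same with the unit made explicit. [cite: VillamayorU2008ReesDiff, §4.1] -/
theorem exists_hasseDeriv_isUnit_of_adicOrder_eq {f : MvPowerSeries σ K} {δ : ℕ}
    (h : Literature.AlgebraicGeometry.Resolution.adicOrder f = δ) :
    ∃ α : σ →₀ ℕ, α.degree = δ ∧ IsUnit (hasseDeriv α f) := by
  rw [adicOrder_eq_order] at h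
  exact exists_hasseDeriv_isUnit_of_order_eq h

/-- No divided derivative of order `< ord f` produces a unit: `1 ≤ ord (Δ_α f)` for `|α| < ord f` («`Diff^{b−1}(I)` is
proper if `I` has order at least `b`»). [cite: VillamayorU2008ReesDiff, §4.1] -/
theorem one_le_adicOrder_hasseDeriv_of_degree_lt {f : MvPowerSeries σ K} {α : σ →₀ ℕ}
    (h : (α.degree : ℕ∞) < Literature.AlgebraicGeometry.Resolution.adicOrder f) :
    1 ≤ Literature.AlgebraicGeometry.Resolution.adicOrder (hasseDeriv α f) := by
  rw [adicOrder_eq_order] at h ⊢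
  exact MvPowerSeries.one_le_order_iff_constCoeff_eq_zero.mpr (constantCoeff_hasseDeriv_eq_zero_of_degree_lt h)

end Field

end Literature.RingTheory.MvPowerSeries

end
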